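import Summits.CriticalPhenomena.CardyFormulaZ2.Theses.CardyQContinuation
import Summits.CriticalPhenomena.CardyFormulaZ2.Theorems.CardyQContinuationPivotalCancellationAtOneJets
import Literature.Probability.LatticeModels.FKTwoArcPartitionPolynomials

/-!
# The self-dual crossing ratio `P_δ(s)` of route CardyQContinuation IS the two-arc FK polynomial
ratio `N_δ(s) / Z^joint_δ(s)` — bridge to the Literature API (serves stmt-CriticalPhenomena-5560)

The items of route CardyQContinuation (`Summits/CriticalPhenomena/CardyFormulaZ2/Theses/
CardyQContinuation.lean`) write the self-dual random-cluster data of a conformal rectangle `R` at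
mesh `δ` INLINE, over configurations `ω ⊆ E(Ω_δ)` of the graph `discreteDomainGraph R.carrier δ`
on all of `Site 2 = ℤ²`:

* weight `w_s(ω) = s ^ (|ω| + 2 k_B(ω))`, `k_B(ω) = ` number of connected components of
  `(openGraph ω ⊔ wired B).induce (meshDomain R.carrier δ)`, `B = (ab)_δ ∪ (cd)_δ`
  (`discreteArc` of `R.arc 0` and of `R.arc 2`, wired JOINTLY);
* `Z_δ(s) = Σᶠ_{ω ∈ 𝒫 E(Ω_δ)} w_s(ω)`, `N_δ(s) = Σᶠ_{ω ∈ 𝒫 E(Ω_δ)} 𝟙_{C_δ}(ω) w_s(ω)` with Smirnov's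
  crossing event `C_δ = discreteCrossing R.carrier δ (R.arc 0) (R.arc 2)`, and `P_δ = N_δ / Z_δ`.

The Literature file `Literature/Probability/LatticeModels/FKTwoArcPartitionPolynomials.lean` has
the same objects as genuine polynomials `fkTwoArcPartitionPolynomials R δ .joint` (`Z^joint_δ`) and
`fkTwoArcCrossingPolynomial R δ .joint` (`N_δ`) in `ℕ[X]`, built on the SUBTYPE graph
`domainSubgraph R.carrier δ` (vertex type `↥(meshDomain R.carrier δ)`) with the arcs `rectArc`
and the pulled-back event `rectCrossing`, and it identifies `N_δ(t)/Z^joint_δ(t)` at real `t > 0`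
with the `fkDomainMeasure` (finite-volume FK measure, `p = t/(1+t)`, `q = t²`, wired on the
discrete arc of `(ab) ∪ (cd)`) of `C_δ` (`measureReal_fkDomainMeasure_discreteCrossing`).

This file proves the dictionary between the two presentations (step 0 of any transplant of a
published FK-Ising crossing theorem, e.g. Chelkak–Smirnov 2012 Thm 6.1, to the route's item
`IsingJetsConformal`, stmt-CriticalPhenomena-5560):

* `powerset_edgeSet_discreteDomainGraph_eq_image`, `induce_openGraph_image_sup_wired`: lifting
  configurations of the subtype graph along `ω' ↦ Sym2.map Subtype.val '' ω'` is a bijection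
  `𝒫 E(domainSubgraph) → 𝒫 E(discreteDomainGraph)` under which the inline induced cluster graph is
  literally `openGraph ω' ⊔ wired (rectArc R δ 0 ∪ rectArc R δ 2)`;
* `finsum_weight_eq_aeval`, `finsum_indicator_weight_eq_aeval`: for `δ > 0` and `s` in any
  commutative semiring, inline `Z_δ(s) = aeval s (fkTwoArcPartitionPolynomials R δ .joint)` and
  inline `N_δ(s) = aeval s (fkTwoArcCrossingPolynomial R δ .joint)`;
* `crossingRatio_eq_aeval_div` (and `crossingRatio_eq`, as functions of `s`),
  `crossingRatio_ofReal`, `crossingRatio_ofReal_eq_measureReal` (and `…_eq_dite_measureReal`,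
  the `u_R(t, δ)` of the sibling route CardyUSTContinuation),
  `crossingRatio_sqrt_two_eq_measureReal`: hence `P_δ(s) = N_δ(s)/Z_δ(s)` as polynomials,
  `P_δ(t)` is real for real `t`, equals the FK crossing probability for `t > 0`, and at `t = √2`
  it is the critical FK-Ising (`q = 2`, `p = √2/(1+√2)`) probability of `C_δ` with
  `(ab)_δ ∪ (cd)_δ` wired;
* `tendsto_crossingRatio_ofReal_iff`: convergence of `δ ↦ P_δ(t)` as `δ → 0⁺` to a real limit is
  convergence of the real polynomial ratio `N_δ(t) / Z^joint_δ(t)` (the form in which a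
  scaling-limit theorem about FK crossing probabilities is quoted).

The companion file
`Theorems/CardyQContinuationIsingJetsConformalStubIsingCrossingConformalNormalisation.lean`
treats the other bookkeeping step of such a transplant, the change of wiring NORMALISATION
(Chelkak–Smirnov's loop-symmetric `N/(N + √2 M)` versus the route's joint `N/(N + M) = N/Z^joint`,
a Möbius reparametrisation `P_joint = √2 p / (√2 p + 1 - p)`), purely in terms of the two-arc
polynomials; `rw [tendsto_crossingRatio_ofReal_iff]` followed by its
`tendsto_aeval_div_of_tendsto_loopSymmetric` turns a loop-symmetric limit `p` for `R` into the
limit `√2 p / (√2 p + 1 - p)` of the inline `P_δ(√2)`.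

NOT here: any scaling-limit statement (Chelkak–Smirnov 2012 Thm 6.1 is not in the tree), hence
no proof of the stub `stub_isingCrossingConformal` of the crux skeleton.

References: G. Grimmett, *The Random-Cluster Model* (2006), §6.1 eq. (6.9); S. Smirnov, *Conformal
invariance in random cluster models I*, Ann. Math. 172 (2010), §2; D. Chelkak, S. Smirnov, Invent.
Math. 189 (2012), §6, Thm 6.1.
-/

namespace Summit.CriticalPhenomena.CardyFormulaZ2.Theorems.CardyQContinuation

open Filter Set Polynomial
open scoped Topology Polynomial
open Literature.Probability.LatticeModels Literature.Probability.Percolation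
open Literature.Probability.RandomPlanarGeometry

noncomputable section

/-! ### Lifting configurations of the subtype graph `Ω_δ` to configurations of `ℤ²` -/

section Lift

variable {Ω : Set ℂ} {δ : ℝ}

/-- The lift `ω' ↦ Sym2.map Subtype.val '' ω'` of bond configurations of the vertex type
`↥(meshDomain Ω δ)` to bond configurations of `Site 2` is injective. [folklore] -/
theorem image_sym2Map_val_injective :
    Function.Injective fun ω' : Set (Sym2 (meshDomain Ω δ)) => Sym2.map Subtype.val '' ω' :=
  Set.image_injective.2 (Sym2.map.injective Subtype.val_injective)

/-- The lift preserves the number of edges: `|Sym2.map val '' ω'| = |ω'|`. [folklore] -/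
theorem ncard_image_sym2Map_val (ω' : Set (Sym2 (meshDomain Ω δ))) :
    (Sym2.map Subtype.val '' ω').ncard = ω'.ncard :=
  Set.ncard_image_of_injective _ (Sym2.map.injective Subtype.val_injective)

/-- An edge of the subtype graph `domainSubgraph Ω δ` lifts to an edge of `discreteDomainGraph Ω δ`.
[folklore] -/
theorem sym2Map_val_mem_edgeSet {e : Sym2 (meshDomain Ω δ)}
    (he : e ∈ (domainSubgraph Ω δ).edgeSet) :
    Sym2.map Subtype.val e ∈ (discreteDomainGraph Ω δ).edgeSet := by
  induction e using Sym2.ind with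
  | h u v =>
    rw [SimpleGraph.mem_edgeSet, domainSubgraph, SimpleGraph.comap_adj] at he
    simpa using he

/-- Every edge of `discreteDomainGraph Ω δ` is the lift of an edge of the subtype graph (both its
endpoints lie in `meshDomain Ω δ`). [folklore] -/
theorem edgeSet_discreteDomainGraph_subset_range :
    (discreteDomainGraph Ω δ).edgeSet ⊆
      Set.range (Sym2.map (Subtype.val : meshDomain Ω δ → Site 2)) := by
  intro e he
  induction e using Sym2.ind with
  | h x y =>
    obtain ⟨-, hx, hy⟩ := discreteDomainGraph_adj_iff.1 ((SimpleGraph.mem_edgeSet _).1 he)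
    exact ⟨s(⟨x, hx⟩, ⟨y, hy⟩), by simp⟩

/-- **Configurations of `Ω_δ ⊆ ℤ²` are exactly the lifts of configurations of the subtype graph**:
`𝒫 E(discreteDomainGraph Ω δ)` is the image of `𝒫 E(domainSubgraph Ω δ)` under the (injective)
lift `ω' ↦ Sym2.map Subtype.val '' ω'`. [folklore] -/
theorem powerset_edgeSet_discreteDomainGraph_eq_image :
    𝒫 (discreteDomainGraph Ω δ).edgeSet =
      (fun ω' : Set (Sym2 (meshDomain Ω δ)) => Sym2.map Subtype.val '' ω') ''
        𝒫 (domainSubgraph Ω δ).edgeSet := by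
  ext ω
  simp only [Set.mem_powerset_iff, Set.mem_image]
  constructor
  · intro hω
    refine ⟨Sym2.map Subtype.val ⁻¹' ω, fun e he => ?_,
      Set.image_preimage_eq_of_subset (hω.trans edgeSet_discreteDomainGraph_subset_range)⟩
    induction e using Sym2.ind with
    | h u v =>
      have huv : s(u.1, v.1) ∈ (discreteDomainGraph Ω δ).edgeSet := hω (by simpa using he)
      rw [SimpleGraph.mem_edgeSet, domainSubgraph, SimpleGraph.comap_adj]
      exact (SimpleGraph.mem_edgeSet _).1 huv
  · rintro ⟨ω', hω', rfl⟩
    rintro e ⟨e', he', rfl⟩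
    exact sym2Map_val_mem_edgeSet (hω' he')

/-- **The inline cluster graph is the subtype cluster graph.** For a configuration `ω'` of the
vertex type `↥(meshDomain Ω δ)` and a set `B ⊆ ℤ²` to be wired, the graph
`(openGraph (lift ω') ⊔ wired B).induce (meshDomain Ω δ)` of the route's inline cluster count IS
`openGraph ω' ⊔ wired (Subtype.val ⁻¹' B)`. [folklore] -/
theorem induce_openGraph_image_sup_wired (ω' : Set (Sym2 (meshDomain Ω δ))) (B : Set (Site 2)) :
    (openGraph (Sym2.map Subtype.val '' ω') ⊔ wired B).induce (meshDomain Ω δ) =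
      openGraph ω' ⊔ wired (Subtype.val ⁻¹' B) := by
  ext u v
  simp only [SimpleGraph.induce_adj, SimpleGraph.sup_adj, wired_adj, Set.mem_preimage, ne_eq,
    Subtype.coe_inj]
  refine or_congr_left ?_
  rw [openGraph_lift_adj_iff]
  exact ⟨fun ⟨_, _, h⟩ => h, fun h => ⟨u.2, v.2, h⟩⟩

/-- Hence the inline cluster count `k_B(lift ω')` is the cluster count of `ω'` with
`Subtype.val ⁻¹' B` wired. [folklore] -/
theorem natCard_connectedComponent_induce_openGraph_image (ω' : Set (Sym2 (meshDomain Ω δ)))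
    (B : Set (Site 2)) :
    Nat.card ((openGraph (Sym2.map Subtype.val '' ω') ⊔ wired B).induce
        (meshDomain Ω δ)).ConnectedComponent =
      Nat.card (openGraph ω' ⊔ wired (Subtype.val ⁻¹' B)).ConnectedComponent := by
  rw [induce_openGraph_image_sup_wired]

end Lift

/-! ### The inline `Z_δ`, `N_δ` are the two-arc polynomials -/

section Bridge

variable (R : ConformalRectangle) {δ : ℝ}

/-- **Inline `Z_δ(s)` = `Z^joint_δ(s)`.** For `δ > 0` and `s` in any commutative semiring, the
route's inline self-dual arc partition function `Σᶠ_{ω ⊆ E(Ω_δ)} s^(|ω| + 2 k_B(ω))` (arcs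
`(ab)_δ ∪ (cd)_δ` jointly wired, clusters counted in `Ω_δ`) is the evaluation at `s` of
`fkTwoArcPartitionPolynomials R δ .joint`. [folklore] -/
theorem finsum_weight_eq_aeval (hδ : 0 < δ) {S : Type*} [CommSemiring S] (s : S) :
    ∑ᶠ ω ∈ 𝒫 (discreteDomainGraph R.carrier δ).edgeSet,
        s ^ (ω.ncard + 2 * Nat.card ((openGraph ω ⊔ wired
          (discreteArc R.carrier δ (R.arc 0) ∪ discreteArc R.carrier δ (R.arc 2))).induce
          (meshDomain R.carrier δ)).ConnectedComponent)
      = aeval s (fkTwoArcPartitionPolynomials R δ .joint) := by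
  classical
  letI : Fintype (meshDomain R.carrier δ) := (meshDomain_finite R.isBounded hδ).fintype
  rw [fkTwoArcPartitionPolynomials_of_pos R hδ, aeval_rcArcPolynomial,
    powerset_edgeSet_discreteDomainGraph_eq_image,
    finsum_mem_image image_sym2Map_val_injective.injOn, ← SimpleGraph.coe_edgeFinset,
    finsum_mem_powerset_coe_eq_sum]
  refine Finset.sum_congr rfl fun T _ => ?_
  rw [ncard_image_sym2Map_val, Set.ncard_coe_finset,
    natCard_connectedComponent_induce_openGraph_image, Set.preimage_union, arcClusterCount_joint]
  rfl

/-- **Inline `N_δ(s)` = `N_δ(s)` of the Literature file.** For `δ > 0` and `s` in any commutative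
semiring, the route's inline crossing-restricted sum `Σᶠ_{ω ⊆ E(Ω_δ)} 𝟙_{C_δ}(ω) s^(|ω| + 2 k_B(ω))`
is the evaluation at `s` of `fkTwoArcCrossingPolynomial R δ .joint`. [folklore] -/
theorem finsum_indicator_weight_eq_aeval (hδ : 0 < δ) {S : Type*} [CommSemiring S] (s : S) :
    ∑ᶠ ω ∈ 𝒫 (discreteDomainGraph R.carrier δ).edgeSet,
        (discreteCrossing R.carrier δ (R.arc 0) (R.arc 2)).indicator
          (fun ω => s ^ (ω.ncard + 2 * Nat.card ((openGraph ω ⊔ wired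
            (discreteArc R.carrier δ (R.arc 0) ∪ discreteArc R.carrier δ (R.arc 2))).induce
            (meshDomain R.carrier δ)).ConnectedComponent)) ω
      = aeval s (fkTwoArcCrossingPolynomial R δ .joint) := by
  classical
  letI : Fintype (meshDomain R.carrier δ) := (meshDomain_finite R.isBounded hδ).fintype
  rw [fkTwoArcCrossingPolynomial_of_pos R hδ, aeval_rcArcPolynomialIn, Finset.sum_filter,
    powerset_edgeSet_discreteDomainGraph_eq_image,
    finsum_mem_image image_sym2Map_val_injective.injOn, ← SimpleGraph.coe_edgeFinset,
    finsum_mem_powerset_coe_eq_sum]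
  refine Finset.sum_congr rfl fun T _ => ?_
  by_cases hT : (↑T : BondConfig (meshDomain R.carrier δ)) ∈ rectCrossing R δ
  · have hT' : Sym2.map Subtype.val '' (↑T : Set (Sym2 (meshDomain R.carrier δ))) ∈
        discreteCrossing R.carrier δ (R.arc 0) (R.arc 2) := hT
    rw [if_pos hT, Set.indicator_of_mem hT', ncard_image_sym2Map_val, Set.ncard_coe_finset,
      natCard_connectedComponent_induce_openGraph_image, Set.preimage_union, arcClusterCount_joint]
    rfl
  · have hT' : Sym2.map Subtype.val '' (↑T : Set (Sym2 (meshDomain R.carrier δ))) ∉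
        discreteCrossing R.carrier δ (R.arc 0) (R.arc 2) := hT
    rw [if_neg hT, Set.indicator_of_notMem hT']

/-- **`P_δ(s) = N_δ(s) / Z^joint_δ(s)`**: for `δ > 0` the route's inline crossing ratio is the ratio
of the two-arc polynomials of the Literature file, at every complex `s`. [folklore] -/
theorem crossingRatio_eq_aeval_div (hδ : 0 < δ) (s : ℂ) :
    (∑ᶠ ω ∈ 𝒫 (discreteDomainGraph R.carrier δ).edgeSet,
        (discreteCrossing R.carrier δ (R.arc 0) (R.arc 2)).indicator
          (fun ω => s ^ (ω.ncard + 2 * Nat.card ((openGraph ω ⊔ wired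
            (discreteArc R.carrier δ (R.arc 0) ∪ discreteArc R.carrier δ (R.arc 2))).induce
            (meshDomain R.carrier δ)).ConnectedComponent)) ω) /
      (∑ᶠ ω ∈ 𝒫 (discreteDomainGraph R.carrier δ).edgeSet,
        s ^ (ω.ncard + 2 * Nat.card ((openGraph ω ⊔ wired
          (discreteArc R.carrier δ (R.arc 0) ∪ discreteArc R.carrier δ (R.arc 2))).induce
          (meshDomain R.carrier δ)).ConnectedComponent))
      = aeval s (fkTwoArcCrossingPolynomial R δ .joint) /
          aeval s (fkTwoArcPartitionPolynomials R δ .joint) := by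
  rw [finsum_indicator_weight_eq_aeval R hδ, finsum_weight_eq_aeval R hδ]

/-- **`P_δ = N_δ / Z^joint_δ` as functions of `s`** (for `δ > 0`): the form needed for the
`s`-jets `iteratedDeriv n (P_δ) s₀` of the route's items (`IsingJetsConformal`, `FirstJetConverges`,
`UniformZeroFree`), which are jets of the rational function `N_δ / Z^joint_δ`. [folklore] -/
theorem crossingRatio_eq (hδ : 0 < δ) :
    (fun s : ℂ =>
      (∑ᶠ ω ∈ 𝒫 (discreteDomainGraph R.carrier δ).edgeSet,
        (discreteCrossing R.carrier δ (R.arc 0) (R.arc 2)).indicator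
          (fun ω => s ^ (ω.ncard + 2 * Nat.card ((openGraph ω ⊔ wired
            (discreteArc R.carrier δ (R.arc 0) ∪ discreteArc R.carrier δ (R.arc 2))).induce
            (meshDomain R.carrier δ)).ConnectedComponent)) ω) /
      (∑ᶠ ω ∈ 𝒫 (discreteDomainGraph R.carrier δ).edgeSet,
        s ^ (ω.ncard + 2 * Nat.card ((openGraph ω ⊔ wired
          (discreteArc R.carrier δ (R.arc 0) ∪ discreteArc R.carrier δ (R.arc 2))).induce
          (meshDomain R.carrier δ)).ConnectedComponent)))
      = fun s : ℂ => aeval s (fkTwoArcCrossingPolynomial R δ .joint) /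
          aeval s (fkTwoArcPartitionPolynomials R δ .joint) :=
  funext (crossingRatio_eq_aeval_div R hδ)

/-- **`P_δ` is real on the real axis**: for `δ > 0` and real `t`, `P_δ(t)` is the complexification
of the real ratio `N_δ(t) / Z^joint_δ(t)`. [folklore] -/
theorem crossingRatio_ofReal (hδ : 0 < δ) (t : ℝ) :
    (∑ᶠ ω ∈ 𝒫 (discreteDomainGraph R.carrier δ).edgeSet,
        (discreteCrossing R.carrier δ (R.arc 0) (R.arc 2)).indicator
          (fun ω => (t : ℂ) ^ (ω.ncard + 2 * Nat.card ((openGraph ω ⊔ wired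
            (discreteArc R.carrier δ (R.arc 0) ∪ discreteArc R.carrier δ (R.arc 2))).induce
            (meshDomain R.carrier δ)).ConnectedComponent)) ω) /
      (∑ᶠ ω ∈ 𝒫 (discreteDomainGraph R.carrier δ).edgeSet,
        (t : ℂ) ^ (ω.ncard + 2 * Nat.card ((openGraph ω ⊔ wired
          (discreteArc R.carrier δ (R.arc 0) ∪ discreteArc R.carrier δ (R.arc 2))).induce
          (meshDomain R.carrier δ)).ConnectedComponent))
      = ((aeval t (fkTwoArcCrossingPolynomial R δ .joint) /
          aeval t (fkTwoArcPartitionPolynomials R δ .joint) : ℝ) : ℂ) := by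
  rw [crossingRatio_eq_aeval_div R hδ, Complex.ofReal_div, ← Complex.coe_algebraMap,
    aeval_algebraMap_apply, aeval_algebraMap_apply]

/-- **`P_δ(t)` is the FK crossing probability** (route CardyQContinuation ↔ `RandomCluster.lean`):
for `δ > 0` and `t > 0`, the route's inline crossing ratio at `s = t` is the probability of Smirnov
crossing event `C_δ(Ω; (ab), (cd))` under the finite-volume random-cluster measure of `Ω_δ` with
`p = t/(1+t)`, `q = t²`, wired on the discrete arc of `(ab) ∪ (cd)` (for any `Fintype` instance
on the vertex set). (Grimmett 2006, §6.1 eq. (6.9).) [folklore] -/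
theorem crossingRatio_ofReal_eq_measureReal (hδ : 0 < δ) {t : ℝ} (ht : 0 < t)
    [Fintype (meshDomain R.carrier δ)] :
    (∑ᶠ ω ∈ 𝒫 (discreteDomainGraph R.carrier δ).edgeSet,
        (discreteCrossing R.carrier δ (R.arc 0) (R.arc 2)).indicator
          (fun ω => (t : ℂ) ^ (ω.ncard + 2 * Nat.card ((openGraph ω ⊔ wired
            (discreteArc R.carrier δ (R.arc 0) ∪ discreteArc R.carrier δ (R.arc 2))).induce
            (meshDomain R.carrier δ)).ConnectedComponent)) ω) /
      (∑ᶠ ω ∈ 𝒫 (discreteDomainGraph R.carrier δ).edgeSet,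
        (t : ℂ) ^ (ω.ncard + 2 * Nat.card ((openGraph ω ⊔ wired
          (discreteArc R.carrier δ (R.arc 0) ∪ discreteArc R.carrier δ (R.arc 2))).induce
          (meshDomain R.carrier δ)).ConnectedComponent))
      = (((fkDomainMeasure R.carrier δ (t / (1 + t)) (t ^ 2) (R.arc 0 ∪ R.arc 2)).real
          (discreteCrossing R.carrier δ (R.arc 0) (R.arc 2)) : ℝ) : ℂ) := by
  rw [crossingRatio_ofReal R hδ, measureReal_fkDomainMeasure_discreteCrossing R hδ ht]

/-- **Same, in the `dite` form of route CardyUSTContinuation.** The sibling route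
`Theses/CardyUSTContinuation.lean` writes the jointly-wired self-dual FK crossing probability as
`u_R(t, δ) = if h : 0 < δ then (fkDomainMeasure … (meshDomain_finite R.isBounded h).fintype).real
C_δ else 0`; for `δ > 0`, `t > 0` the present route's `P_δ(t)` is `u_R(t, δ)` (so the two
continuation routes speak about the same function on `t > 0`). [folklore] -/
theorem crossingRatio_ofReal_eq_dite_measureReal (hδ : 0 < δ) {t : ℝ} (ht : 0 < t) :
    (∑ᶠ ω ∈ 𝒫 (discreteDomainGraph R.carrier δ).edgeSet,
        (discreteCrossing R.carrier δ (R.arc 0) (R.arc 2)).indicator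
          (fun ω => (t : ℂ) ^ (ω.ncard + 2 * Nat.card ((openGraph ω ⊔ wired
            (discreteArc R.carrier δ (R.arc 0) ∪ discreteArc R.carrier δ (R.arc 2))).induce
            (meshDomain R.carrier δ)).ConnectedComponent)) ω) /
      (∑ᶠ ω ∈ 𝒫 (discreteDomainGraph R.carrier δ).edgeSet,
        (t : ℂ) ^ (ω.ncard + 2 * Nat.card ((openGraph ω ⊔ wired
          (discreteArc R.carrier δ (R.arc 0) ∪ discreteArc R.carrier δ (R.arc 2))).induce
          (meshDomain R.carrier δ)).ConnectedComponent))
      = ((if h : 0 < δ then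
          (@fkDomainMeasure R.carrier δ (t / (1 + t)) (t ^ 2) (R.arc 0 ∪ R.arc 2)
            (meshDomain_finite R.isBounded h).fintype).real
            (discreteCrossing R.carrier δ (R.arc 0) (R.arc 2))
          else 0 : ℝ) : ℂ) := by
  rw [dif_pos hδ]
  exact @crossingRatio_ofReal_eq_measureReal R δ hδ t ht (_)

/-- **At `s = √2` the route's `P_δ` is the critical FK-Ising crossing probability**: `q = 2`,
`p = p_c(2) = √2 / (1 + √2)` (= `criticalFKIsingParam` of `FermionicObservable.lean`), arcs
`(ab)_δ ∪ (cd)_δ` jointly wired — Chelkak–Smirnov's setting (2012, §6) up to their loop-symmetric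
normalisation (a Möbius reparametrisation, see `tendsto_aeval_div_of_tendsto_loopSymmetric` of the
companion normalisation file) and their discretisation of the rectangle. [folklore] -/
theorem crossingRatio_sqrt_two_eq_measureReal (hδ : 0 < δ) [Fintype (meshDomain R.carrier δ)] :
    (∑ᶠ ω ∈ 𝒫 (discreteDomainGraph R.carrier δ).edgeSet,
        (discreteCrossing R.carrier δ (R.arc 0) (R.arc 2)).indicator
          (fun ω => (Real.sqrt 2 : ℂ) ^ (ω.ncard + 2 * Nat.card ((openGraph ω ⊔ wired
            (discreteArc R.carrier δ (R.arc 0) ∪ discreteArc R.carrier δ (R.arc 2))).induce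
            (meshDomain R.carrier δ)).ConnectedComponent)) ω) /
      (∑ᶠ ω ∈ 𝒫 (discreteDomainGraph R.carrier δ).edgeSet,
        (Real.sqrt 2 : ℂ) ^ (ω.ncard + 2 * Nat.card ((openGraph ω ⊔ wired
          (discreteArc R.carrier δ (R.arc 0) ∪ discreteArc R.carrier δ (R.arc 2))).induce
          (meshDomain R.carrier δ)).ConnectedComponent))
      = (((fkDomainMeasure R.carrier δ (Real.sqrt 2 / (1 + Real.sqrt 2)) 2 (R.arc 0 ∪ R.arc 2)).real
          (discreteCrossing R.carrier δ (R.arc 0) (R.arc 2)) : ℝ) : ℂ) := by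
  rw [crossingRatio_ofReal_eq_measureReal R hδ (Real.sqrt_pos.2 two_pos),
    Real.sq_sqrt zero_le_two]

/-- **Convergence of `P_δ(t)` is convergence of the real polynomial ratio.** For real `t` and a real
candidate limit `p`, `P_δ(t) → p` (in `ℂ`) as `δ → 0⁺` iff
`N_δ(t) / Z^joint_δ(t) → p` (in `ℝ`): the form in which a scaling-limit theorem about FK crossing
probabilities enters the route. [folklore] -/
theorem tendsto_crossingRatio_ofReal_iff (t p : ℝ) :
    Tendsto (fun δ : ℝ =>
      (∑ᶠ ω ∈ 𝒫 (discreteDomainGraph R.carrier δ).edgeSet,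
        (discreteCrossing R.carrier δ (R.arc 0) (R.arc 2)).indicator
          (fun ω => (t : ℂ) ^ (ω.ncard + 2 * Nat.card ((openGraph ω ⊔ wired
            (discreteArc R.carrier δ (R.arc 0) ∪ discreteArc R.carrier δ (R.arc 2))).induce
            (meshDomain R.carrier δ)).ConnectedComponent)) ω) /
      (∑ᶠ ω ∈ 𝒫 (discreteDomainGraph R.carrier δ).edgeSet,
        (t : ℂ) ^ (ω.ncard + 2 * Nat.card ((openGraph ω ⊔ wired
          (discreteArc R.carrier δ (R.arc 0) ∪ discreteArc R.carrier δ (R.arc 2))).induce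
          (meshDomain R.carrier δ)).ConnectedComponent)))
      (𝓝[>] 0) (𝓝 (p : ℂ)) ↔
    Tendsto (fun δ : ℝ => aeval t (fkTwoArcCrossingPolynomial R δ .joint) /
        aeval t (fkTwoArcPartitionPolynomials R δ .joint)) (𝓝[>] 0) (𝓝 p) := by
  rw [← tendsto_ofReal_iff]
  refine Filter.tendsto_congr' ?_
  filter_upwards [self_mem_nhdsWithin] with δ hδ
  exact crossingRatio_ofReal R hδ t

end Bridge

end

end Summit.CriticalPhenomena.CardyFormulaZ2.Theorems.CardyQContinuation
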